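import Literature.AlgebraicGeometry.Frobenioids.EquivalenceIstrSquare
import Literature.AlgebraicGeometry.Frobenioids.DivisorMonoidCategoryTheoreticityCorProofsV
import Literature.AlgebraicGeometry.Frobenioids.BaseSquareComposition
import HarnessLib

/-!
# Frobenioids I, Corollary 4.11 (ii) — the reductions: the base square descends along functors lying
# over the base ("composing diagrams"), in particular along the isotropifications `C_i → C_i^istr`

Mochizuki, *The geometry of Frobenioids I: the general theory*, Kyushu J. Math. **62** (2008)
293–400, proof of Cor. 4.11, kurims text p. 92 ll. 22–23 [cite: MochizukiFrdI2008, Cor. 4.11 p.92]: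

> "First, we observe [cf. Theorem 3.4, (i)] that we may assume without loss of generality that `C₁, C₂`
> are of isotropic type [cf. Remark 4.5.1]."

and p. 94 ll. 6–8: "Thus, by composing diagrams, we obtain a 1-commutative diagram as in the statement of
assertion (ii), which is easily verified to be 1-unique. Finally, the rigidity assertion … follows from
Proposition 1.13, (i)."

PROOF-ONLY file (seat abc-iut-L1-d6, cell sub-DAG S2 `plan/L1/SUBDAG-FrdI-Cor411.md`, row L00 "reduction of
general `C_i` to isotropic type"). The mechanism, once and for all: if the base functors `C_i → D_i` factor up
to isomorphism through functors `T_i : C_i → C_i'` into pre-Frobenioids `C_i' → D_i` over the SAME bases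
(`T_i ⋙ Base_i' ≅ Base_i`), and `Ψ' : C₁' ⥲ C₂'` lies over `Ψ` (`T₁ ⋙ Ψ' ≅ Ψ ⋙ T₂`), then a base square for
`Ψ'` is a base square for `Ψ` (`exists_base_equivalence_of_over`, `cor411ii_of_over` — `1`-uniqueness and
rigidity for Frobenioids by `cor411ii_of_exists_base_equivalence'`). Instances: the isotropifications
(`T_i :=` abc-iut-L1-t1's `isotropification`, over the base by the isotropic hulls — isometric pre-steps,
whose images in `F_Φ` are isomorphisms, `isotropificationFactorsIso`; `Ψ' := Ψ^istr` of Thm. 3.4 (i), over `Ψ`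
by abc-iut-w4-d088's `nonempty_isotropification_comp_iso`): `exists_base_equivalence_of_istr`,
`cor411ii_of_istr`, `cor411ii_of_istr_of_quasiIsotropic`; the perfections `C_i → C_i^pf` of Thm. 3.4 (iii)
("by passing to perfections", proof of Thm. 4.2 p. 78) are the other intended instance (`toPf`,
`PerfectionFunctoriality.toPfCompMapIso`). No new definitions; nothing of the paper is restated; nothing
here is specific to the abc programme.
-/

namespace Literature.AlgebraicGeometry.Frobenioids

open CategoryTheory Opposite

universe w w' v v' u u' v₃ u₃ v₄ u₄

namespace PreFrobenioid

/-! ### Generic: a base square descends along functors over the base -/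

section Over

variable {D₁ : Type u} [Category.{v} D₁] {Φ₁ : D₁ᵒᵖ ⥤ CommMonCat.{w}}
  {C₁ : Type u'} [Category.{v'} C₁] {F₁ : C₁ ⥤ ElemFrobenioid Φ₁}
  {D₂ : Type u} [Category.{v} D₂] {Φ₂ : D₂ᵒᵖ ⥤ CommMonCat.{w}}
  {C₂ : Type u'} [Category.{v'} C₂] {F₂ : C₂ ⥤ ElemFrobenioid Φ₂}
  {U₁ : Type u₃} [Category.{v₃} U₁] {U₂ : Type u₄} [Category.{v₄} U₂]

/-- **"By composing diagrams"** (FrdI p. 94 ll. 6–7), existential form: if `Base_i` factors through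
`T_i : C_i → U_i` up to isomorphism (`T_i ⋙ B_i ≅ Base_i` for functors `B_i : U_i → D_i`), `Ψ^U : U₁ ⥤ U₂`
lies over `Ψ` (`T₁ ⋙ Ψ^U ≅ Ψ ⋙ T₂`), and there is an equivalence `Ψ^Base` with `B₂ ∘ Ψ^U ≅ Ψ^Base ∘ B₁`, then
`Base₂ ∘ Ψ ≅ Ψ^Base ∘ Base₁`. [cite: MochizukiFrdI2008, Cor. 4.11 (ii) p.94] -/
theorem exists_base_equivalence_of_over (Ψ : C₁ ≌ C₂) (T₁ : C₁ ⥤ U₁) (T₂ : C₂ ⥤ U₂)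
    (B₁ : U₁ ⥤ D₁) (B₂ : U₂ ⥤ D₂)
    (ι₁ : T₁ ⋙ B₁ ≅ (PreFrobenioidData.ofFunctor Φ₁ F₁).base)
    (ι₂ : T₂ ⋙ B₂ ≅ (PreFrobenioidData.ofFunctor Φ₂ F₂).base)
    (ΨU : U₁ ⥤ U₂) (hT : OneCommutes Ψ.functor T₂ T₁ ΨU)
    (hex : ∃ ΨBase : D₁ ⥤ D₂, ΨBase.IsEquivalence ∧ OneCommutes ΨU B₂ B₁ ΨBase) :
    ∃ ΨBase : D₁ ⥤ D₂, ΨBase.IsEquivalence ∧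
      OneCommutes Ψ.functor (PreFrobenioidData.ofFunctor Φ₂ F₂).base (PreFrobenioidData.ofFunctor Φ₁ F₁).base
        ΨBase := by
  obtain ⟨ΨBase, hEq, ⟨σ⟩⟩ := hex
  obtain ⟨τ⟩ := hT
  exact ⟨ΨBase, hEq, ⟨Functor.isoWhiskerLeft Ψ.functor ι₂.symm ≪≫ (Functor.associator _ _ _).symm ≪≫
    Functor.isoWhiskerRight τ B₂ ≪≫ Functor.associator _ _ _ ≪≫ Functor.isoWhiskerLeft T₁ σ ≪≫
    (Functor.associator _ _ _).symm ≪≫ Functor.isoWhiskerRight ι₁ ΨBase⟩⟩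

/-- **Corollary 4.11 (ii) for `Ψ` from a base square one floor up** (FrdI p. 94 ll. 6–8): under the
hypotheses of `exists_base_equivalence_of_over`, for Frobenioids `C_i`, the typed Cor. 4.11 (ii) holds for
`Ψ` ("easily verified to be 1-unique"; rigidity "from Proposition 1.13, (i)" —
`cor411ii_of_exists_base_equivalence'`). [cite: MochizukiFrdI2008, Cor. 4.11 (ii) p.94] -/
theorem cor411ii_of_over (hF₁ : IsFrobenioid F₁) (hF₂ : IsFrobenioid F₂) (Ψ : C₁ ≌ C₂)
    (T₁ : C₁ ⥤ U₁) (T₂ : C₂ ⥤ U₂) (B₁ : U₁ ⥤ D₁) (B₂ : U₂ ⥤ D₂)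
    (ι₁ : T₁ ⋙ B₁ ≅ (PreFrobenioidData.ofFunctor Φ₁ F₁).base)
    (ι₂ : T₂ ⋙ B₂ ≅ (PreFrobenioidData.ofFunctor Φ₂ F₂).base)
    (ΨU : U₁ ⥤ U₂) (hT : OneCommutes Ψ.functor T₂ T₁ ΨU)
    (hex : ∃ ΨBase : D₁ ⥤ D₂, ΨBase.IsEquivalence ∧ OneCommutes ΨU B₂ B₁ ΨBase) :
    (PreFrobenioidData.ofFunctor Φ₁ F₁).Cor411ii (PreFrobenioidData.ofFunctor Φ₂ F₂) Ψ :=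
  cor411ii_of_exists_base_equivalence' F₁ F₂ Ψ hF₁ hF₂
    (exists_base_equivalence_of_over Ψ T₁ T₂ B₁ B₂ ι₁ ι₂ ΨU hT hex)

end Over

/-! ### The base functor factors through the isotropification -/

section OneFrobenioid

variable {D : Type u} [Category.{v} D] {Φ : Dᵒᵖ ⥤ CommMonCat.{w}}
  {C : Type u'} [Category.{v'} C]

/-- The base functor `C → D` of `C → F_Φ` is, ON THE NOSE, `C → F_Φ` followed by the base functor
`F_Φ → D` of the elementary Frobenioid itself. [cite: MochizukiFrdI2008, Def. 1.3 p.24] -/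
theorem base_eq_comp_elem (F : C ⥤ ElemFrobenioid Φ) :
    (PreFrobenioidData.ofFunctor Φ F).base =
      F ⋙ (PreFrobenioidData.ofFunctor Φ (𝟭 (ElemFrobenioid Φ))).base :=
  Functor.hext (fun _ => rfl) fun _ _ _ => HEq.rfl

variable {F : C ⥤ ElemFrobenioid Φ}

/-- **The mechanism of "we may assume `C` is of isotropic type [cf. Theorem 3.4, (i)]"** (FrdI p. 92
l. 22): the base functor `C → D` is canonically isomorphic to the isotropification functor `C → C^istr`
(Prop. 1.9 (v)) followed by the base functor `C^istr → D` — an isotropic hull `A → A^istr` being an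
isometric pre-step, its image in `F_Φ` is an isomorphism (`isotropificationFactorsIso`, abc-iut-L1-t1).
[cite: MochizukiFrdI2008, Cor. 4.11 p.92] -/
theorem nonempty_base_iso_isotropification_comp (hF : IsFrobenioid F) :
    Nonempty (isotropification hF ⋙ (PreFrobenioidData.ofFunctor Φ (istrFunctor F)).base ≅
      (PreFrobenioidData.ofFunctor Φ F).base) :=
  ⟨(eqToIso (base_eq_comp_elem F) ≪≫
    Functor.isoWhiskerRight (isotropificationFactorsIso hF) _ ≪≫ Functor.associator _ _ _ ≪≫
      Functor.isoWhiskerLeft (isotropification hF) (eqToIso (base_eq_comp_elem (istrFunctor F)).symm)).symm⟩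

end OneFrobenioid

/-! ### Row L00: the descent along the isotropifications -/

section TwoFrobenioids

variable {D₁ : Type u} [Category.{v} D₁] {Φ₁ : D₁ᵒᵖ ⥤ CommMonCat.{w}}
  {C₁ : Type u'} [Category.{v'} C₁] {F₁ : C₁ ⥤ ElemFrobenioid Φ₁}
  {D₂ : Type u} [Category.{v} D₂] {Φ₂ : D₂ᵒᵖ ⥤ CommMonCat.{w}}
  {C₂ : Type u'} [Category.{v'} C₂] {F₂ : C₂ ⥤ ElemFrobenioid Φ₂}

/-- **Row L00, the descent** (FrdI p. 92 l. 22 "we may assume without loss of generality that `C₁, C₂`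
are of isotropic type [cf. Theorem 3.4, (i)]"): let `Ψ^istr : C₁^istr ⥲ C₂^istr` be an equivalence with
`isotropification₁ ⋙ Ψ^istr ≅ Ψ ⋙ isotropification₂`. A base square for `Ψ^istr` (over the base functors
of the Frobenioids `C_i^istr → F_{Φ_i}`) is a base square for `Ψ`. [cite: MochizukiFrdI2008, Cor. 4.11 p.92] -/
theorem exists_base_equivalence_of_istr (hF₁ : IsFrobenioid F₁) (hF₂ : IsFrobenioid F₂) (Ψ : C₁ ≌ C₂)
    (Ψi : Istr F₁ ≌ Istr F₂) (core : isotropification hF₁ ⋙ Ψi.functor ≅ Ψ.functor ⋙ isotropification hF₂)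
    (hex : ∃ ΨBase : D₁ ⥤ D₂, ΨBase.IsEquivalence ∧
      OneCommutes Ψi.functor (PreFrobenioidData.ofFunctor Φ₂ (istrFunctor F₂)).base
        (PreFrobenioidData.ofFunctor Φ₁ (istrFunctor F₁)).base ΨBase) :
    ∃ ΨBase : D₁ ⥤ D₂, ΨBase.IsEquivalence ∧
      OneCommutes Ψ.functor (PreFrobenioidData.ofFunctor Φ₂ F₂).base (PreFrobenioidData.ofFunctor Φ₁ F₁).base
        ΨBase := by
  obtain ⟨ι₁⟩ := nonempty_base_iso_isotropification_comp hF₁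
  obtain ⟨ι₂⟩ := nonempty_base_iso_isotropification_comp hF₂
  exact exists_base_equivalence_of_over Ψ (isotropification hF₁) (isotropification hF₂) _ _ ι₁ ι₂
    Ψi.functor ⟨core.symm⟩ hex

/-- **Row L00: Corollary 4.11 (ii) for `Ψ` from the base square for `Ψ^istr`** (FrdI p. 92 l. 22 + p. 94
ll. 6–8): under the hypotheses of `exists_base_equivalence_of_istr` the typed Cor. 4.11 (ii) holds for `Ψ`.
[cite: MochizukiFrdI2008, Cor. 4.11 (ii) p.91] -/
theorem cor411ii_of_istr (hF₁ : IsFrobenioid F₁) (hF₂ : IsFrobenioid F₂) (Ψ : C₁ ≌ C₂)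
    (Ψi : Istr F₁ ≌ Istr F₂) (core : isotropification hF₁ ⋙ Ψi.functor ≅ Ψ.functor ⋙ isotropification hF₂)
    (hex : ∃ ΨBase : D₁ ⥤ D₂, ΨBase.IsEquivalence ∧
      OneCommutes Ψi.functor (PreFrobenioidData.ofFunctor Φ₂ (istrFunctor F₂)).base
        (PreFrobenioidData.ofFunctor Φ₁ (istrFunctor F₁)).base ΨBase) :
    (PreFrobenioidData.ofFunctor Φ₁ F₁).Cor411ii (PreFrobenioidData.ofFunctor Φ₂ F₂) Ψ :=
  cor411ii_of_exists_base_equivalence' F₁ F₂ Ψ hF₁ hF₂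
    (exists_base_equivalence_of_istr hF₁ hF₂ Ψ Ψi core hex)

/-- **Row L00 with THE `Ψ^istr` of Thm. 3.4 (i)** (FrdI p. 92 l. 22): for Frobenioids of quasi-isotropic
type (so that `Ψ` preserves isotropic objects, Thm. 3.4 (i), seat abc-iut-L1-t13's
`isotropicObjects_inverseImage`), `Ψ^istr :=` the restriction of `Ψ` to the isotropic objects lies over `Ψ`
along the isotropifications (uniqueness of left adjoints, seat abc-iut-w4-d088's
`nonempty_isotropification_comp_iso`); hence a base square for this `Ψ^istr` — e.g. the one of
`Cor411iiBiratApex` for the Frobenioids `C_i^istr → F_{Φ_i}` of isotropic type — gives the typed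
Cor. 4.11 (ii) for `Ψ`. [cite: MochizukiFrdI2008, Cor. 4.11 (ii) p.91] -/
theorem cor411ii_of_istr_of_quasiIsotropic (hF₁ : IsFrobenioid F₁) (hF₂ : IsFrobenioid F₂) (Ψ : C₁ ≌ C₂)
    (hq₁ : (PreFrobenioidData.ofFunctor Φ₁ F₁).IsOfQuasiIsotropicType)
    (hq₂ : (PreFrobenioidData.ofFunctor Φ₂ F₂).IsOfQuasiIsotropicType)
    (hex : ∃ ΨBase : D₁ ⥤ D₂, ΨBase.IsEquivalence ∧
      OneCommutes
        (haveI : (isotropicObjects F₂).IsClosedUnderIsomorphisms :=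
          ⟨fun e h => IsIsotropic.of_iso hF₂.isPreFrobenioid e.symm h⟩
        (Ψ.congrFullSubcategory (FrdI.isotropicObjects_inverseImage hF₁ hq₁ hq₂ Ψ)).functor)
        (PreFrobenioidData.ofFunctor Φ₂ (istrFunctor F₂)).base
        (PreFrobenioidData.ofFunctor Φ₁ (istrFunctor F₁)).base ΨBase) :
    (PreFrobenioidData.ofFunctor Φ₁ F₁).Cor411ii (PreFrobenioidData.ofFunctor Φ₂ F₂) Ψ := by
  haveI : (isotropicObjects F₂).IsClosedUnderIsomorphisms :=
    ⟨fun e h => IsIsotropic.of_iso hF₂.isPreFrobenioid e.symm h⟩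
  obtain ⟨core⟩ := nonempty_isotropification_comp_iso hF₁ hF₂ hq₁ hq₂ Ψ
  exact cor411ii_of_istr hF₁ hF₂ Ψ _ core hex

end TwoFrobenioids

end PreFrobenioid

end Literature.AlgebraicGeometry.Frobenioids
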